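import Summits.QuantumFields.YangMills.Theorems.BalabanUVNodesN15KingModelGraphTreeDecayTriangle
import Summits.QuantumFields.YangMills.Theorems.BalabanUVNodesN15KingModelGraphTreeDecayThm35

/-!
# BalabanUVNodes ∕ N15 — THE KING-MODEL RUNG (PART Α-o): A HYPOTHESIS-FREE INSTANCE OF (3.56) SUMMED OVER THE FIELD POINTS — the TRIANGLE in King's own
# dimension `d + 1 = 4` with external lines at fixed unit sites AND at `r` field points summed over the unit lattice: the two-spacing rate `L^{−γK}` with tree
# decay in the fixed points, NOTHING assumed beyond odd `L ≥ 3`, `a > 0`, `m₀² ≥ 0`, `r ≥ 1`, `a_I ≥ 0`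
# (Track A, DAG node N15 = NE2; FAN-OUT v1.1 §N15 s3 «KING-MODEL RUNG … NE2's analogue DECIDED in the model»)

HONEST FRAMING.  Count-neutral (cell `pub-ymgap`, seat `pub-ymgap-dag-n15-e` g29; `--supports stmt-QuantumFields-27366 --as helper` = K3⁸
`SpineGivenEndpointR13SepCoPHV`).  TEMPLATE LITERATURE: C. King, *The U(1) Higgs model. I. The continuum limit*, Commun. Math. Phys. **102** (1986) 649–677
[King1986], Proposition 3.6 (3.56) with (3.57) p. 662 — KING's OWN `A = 0` MODEL.  This file only INSTANTIATES part Α-n's `king_prop36_fieldPoints_extLegs_treeDecay`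
on the triangle of parts Γ-j ∕ Δ-c ∕ Δ-d (connected by `lConn_triangle`; p. 664's sentence by `posSubgraphsBy_triangle`, decided by counting), to exhibit the
hypotheses of parts Α-i ∕ Α-n as INHABITED.  The insertions `A(w)` stay abstract functions of the unit block with (3.45)-type majorants.  NOT Bałaban's `G(U)`;
NOT a node discharge; nothing continuum ∕ ℝ⁴ ∕ OS ∕ mass-gap ∕ Clay.  0 `sorry`; standard axioms.

WHAT THIS FILE PROVES (namespace `Summit.QuantumFields.YangMills.BalabanUVNodes.N15KingModelRung.Curved`).
* ★★ **`king_prop36_triangle_fieldPoints_treeDecay`** — for `d + 1 = 4`: there are `C ≥ 1`, `γ, δ > 0` such that for every mass `0 < m² ≤ m₀²`, volume∕scale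
  index, `n ≥ 1`, every finite family `Υ` of King's external lines on the triangle's vertices at fixed unit sites (one at the vertex `0`, a reference leg `υ₁`),
  every `r ≥ 1` external lines at field points and every insertion `|A(w)| ≤ a_I(1 + |basePt w − y_{υ₁}|)`:
  `|Σ_w (Π_l A(w_l))·(E^{(K+n)}(△; {y_υ}, {w_l}) − E^{(K)}(△; {y_υ}, {w_l}))| ≤ L^{−γK}·C^{8+|Υ|+r}·6·(|Υ| + r + 4)·exp[−(δ∕2)·treeLength |·| {y_υ}]·(a_I(1 + 4r∕δ)e^{δ∕4r}K_4(δ∕4r))^r`.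
* §2 (v1.1) `posDegrees_kingDegList_triangle` ((3.77) verbatim for the triangle, from p. 664's sentence by part Δ-b), ★★ **`king_thm35_triangle_fieldPoints_treeDecay`** — the
  triangle instance of part Α-n's Theorem 3.5 (ii) (3.39) shape: `|Σ_w (Π_l A(w_l))·E^{(K)}(△; {y_υ}, {w_l})| ≤ (Q c368 δ)·C₁^3C₂^2(Σ_π degConst)·Q^{|Υ|+r−1}·exp[−(δ∕2)·treeLength{y_υ}]·(…)^r`,
  NO hypothesis.

HONEST SCOPE.  An instance; the general statements are parts Α-g, Α-i, Α-n.  Locators: [King1986] Prop. 3.6 (3.56)–(3.57) p.662, (3.45) p.661, p.664.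
-/

noncomputable section

namespace Summit.QuantumFields.YangMills.BalabanUVNodes.N15KingModelRung.Curved

open scoped BigOperators
open Finset
open Literature.MathematicalPhysics.QuantumFieldTheory.Balaban1983to89.B4Sect5Proof (latticeConst)
open Literature.MathematicalPhysics.QuantumFieldTheory.Balaban1983to89.B5Prop11Plancherel (Tor fine)
open Summit.QuantumFields.YangMills.BalabanUVNodes.N15KingModelRung (KingVolIndex kingVol kingVol_neZero basePt)
open Summit.QuantumFields.YangMills.BalabanUVNodes.N15KingModelRung.Graph

variable (L : ℕ) [NeZero L]

/-- ★★ **THE TRIANGLE WITH FIXED AND FIELD-POINT EXTERNAL LINES: (3.56) SUMMED OVER THE FIELD POINTS, NO HYPOTHESIS** (`d + 1 = 4`): part Α-n's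
`king_prop36_fieldPoints_extLegs_treeDecay` at `nn = 2`, `m = 3`, `κ ≡ G`, connectedness `lConn_triangle` (part Δ-d) and p. 664's sentence `posSubgraphsBy_triangle`
(part Δ-c).  For every family `Υ` of legs at fixed unit sites (`υ₀` at the vertex `0`, reference leg `υ₁`), `r ≥ 1` legs at field points, insertions
`|A(w)| ≤ a_I(1 + |basePt w − y_{υ₁}|)`:
`|Σ_w (Π_l A(w_l))·(E^{(K+n)}(△) − E^{(K)}(△))({y_υ}, {w_l})| ≤ L^{−γK}·C^{8+(|Υ|+r)}·(6·(|Υ| + r + 4))·exp[−(δ∕2)·treeLength |·| {y_υ}]·(a_I(1 + 4r∕δ)(e^{δ∕(4r)}K_4(δ∕(4r))))^r`.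
[cite: King1986, Prop. 3.6 (3.56)–(3.57) p.662, (3.45) p.661, p.664 («every subgraph has positive degree»)] -/
theorem king_prop36_triangle_fieldPoints_treeDecay (hLodd : Odd L) (hL : 2 ≤ L) {a : ℝ} (ha : 0 < a) {m0sq : ℝ} (hm0 : 0 ≤ m0sq) :
    ∃ C γ δ : ℝ, 1 ≤ C ∧ 0 < γ ∧ 0 < δ ∧ ∀ (msq : ℝ), 0 < msq → msq ≤ m0sq → ∀ (jv : KingVolIndex 3) (n : ℕ), 1 ≤ n →
      ∀ (Υ : Type) [Fintype Υ] [DecidableEq Υ] (vtx : Υ → Fin (2 + 1)) (υ₀ : Υ), vtx υ₀ = 0 →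
      ∀ (b : Υ → Tor (kingVol L jv)) (κe : Υ → Option (Fin (3 + 1))) (υ₁ : Υ) (r : ℕ), 1 ≤ r →
      ∀ (vtxF : Fin r → Fin (2 + 1)) (κF : Fin r → Option (Fin (3 + 1))) (aI : ℝ), 0 ≤ aI → ∀ (A : Tor (kingVol L jv) → ℝ),
        (haveI := kingVol_neZero L jv
         ∀ w, |A w| ≤ aI * (1 + kingDist L jv (basePt (L ^ jv.K) (kingVol L jv) w) (basePt (L ^ jv.K) (kingVol L jv) (b υ₁)))) →
        haveI := kingVol_neZero L jv
        |∑ w : Fin r → Tor (kingVol L jv), (∏ l, A (w l))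
            * (graphValLS ((((L : ℝ) ^ (jv.K + n))⁻¹) ^ (3 + 1)) triSrc triTgt (fun _ => kingGLine L (kingVol L jv) a msq (jv.K + n) none)
                  (Sum.elim vtx vtxF) (fun υ => kingExtHi L a msq jv n (Sum.elim b w υ) (Sum.elim κe κF υ))
              - graphValLS ((((L : ℝ) ^ jv.K)⁻¹) ^ (3 + 1)) triSrc triTgt (fun _ => kingGLine L (kingVol L jv) a msq jv.K none)
                  (Sum.elim vtx vtxF) (fun υ => kingExtLo L a msq jv (Sum.elim b w υ) (Sum.elim κe κF υ)))|
          ≤ ((L : ℝ) ^ (-(γ * jv.K)) * (C ^ (8 + (Fintype.card Υ + r)) * ((6 : ℝ) * (Fintype.card Υ + r + 4))))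
            * Real.exp (-(δ / 2 * treeLength (kingDist L jv) (anchors fun υ => some (basePt (L ^ jv.K) (kingVol L jv) (b υ)))))
            * (aI * (1 + 4 * r / δ) * (Real.exp (δ / (4 * r)) * latticeConst (3 + 1) (δ / (4 * r)))) ^ r := by
  obtain ⟨C, γ, δ, hC, hγ, hδ, H⟩ := king_prop36_fieldPoints_extLegs_treeDecay (d := 3) L hLodd hL ha hm0
  refine ⟨C, γ, δ, hC, hγ, hδ, fun msq hm hcap jv n hn Υ _ _ vtx υ₀ hυ₀ b κe υ₁ r hr vtxF κF aI haI A hA => ?_⟩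
  haveI := kingVol_neZero L jv
  have key := H msq hm hcap jv n hn 2 3 triSrc triTgt lConn_triangle (fun _ => none) (posSubgraphsBy_triangle_lineExp)
    Υ vtx υ₀ hυ₀ b κe υ₁ r hr vtxF κF aI haI A hA
  refine key.trans (le_of_eq ?_)
  have e1 : 2 * 3 + 2 + (Fintype.card Υ + r) = 8 + (Fintype.card Υ + r) := by ring
  have e2 : ((Nat.factorial 3 : ℕ) : ℝ) = 6 := by norm_num [Nat.factorial]
  rw [e1, e2]
  push_cast
  ring

/-! ## §2 (v1.1) The triangle instance of Theorem 3.5 (ii) (3.39)'s shape -/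

/-- reading: the triangle's King degrees are positive along EVERY ordering ((3.77) verbatim) — p. 664's sentence (part Δ-c, by counting) read through part Δ-b's
`posDegreesBy_kingDegList_of_posSubgraphsBy`. [cite: King1986, (3.77) p.666, p.664] -/
theorem posDegrees_kingDegList_triangle (π : Equiv.Perm (Fin 3)) :
    PosDegrees (kingDegList triSrc triTgt (((3 : ℕ) + 1 : ℕ) : ℝ) (fun ℓ => lineExp (3 + 1) ((fun _ : Fin 3 => (none : Option (Fin (3 + 1)))) ℓ)) π) :=
  posDegrees_of_posDegreesBy le_rfl (posDegreesBy_kingDegList_of_posSubgraphsBy le_rfl posSubgraphsBy_triangle_lineExp π)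

/-- ★★ **THE TRIANGLE INSTANCE OF THEOREM 3.5 (ii) (3.39)'s SHAPE, NO HYPOTHESIS** (`d + 1 = 4`): part Α-n's `king_thm35_fieldPoints_extLegs_treeDecay` at `nn = 2`,
`m = 3`, `κ ≡ G`, connectedness `lConn_triangle`, (3.77) by `posDegrees_kingDegList_triangle`.  For every family `Υ` of legs at fixed unit sites (`υ₀` at the vertex `0`,
reference leg `υ₁`), `r ≥ 1` legs at field points summed over the unit lattice, insertions `|A(w)| ≤ a_I(1 + |basePt w − y_{υ₁}|)`:
`|Σ_w (Π_l A(w_l))·E^{(K)}(△; {y_υ}, {w_l})| ≤ (Q·c368 3 δ)·(C₁^3·C₂^2·(Σ_π degConst L (kingDegList △ π))·Q^{|Υ|+r−1})·exp[−(δ∕2)·treeLength |·| {y_υ}]·(a_I(1 + 4r∕δ)(e^{δ∕(4r)}K_4(δ∕(4r))))^r`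
— the size of the triangle with its field-point legs summed out decays exponentially in the tree length of the fixed external points, uniformly in the volume.
[cite: King1986, Thm 3.5 (3.39) p.660, (3.55)–(3.57) p.662, (3.45) p.661, (3.77) p.666] -/
theorem king_thm35_triangle_fieldPoints_treeDecay (hLodd : Odd L) (hL : 2 ≤ L) {a : ℝ} (ha : 0 < a) {m0sq : ℝ} (hm0 : 0 ≤ m0sq) :
    ∃ C₁ C₂ Q δ : ℝ, 0 < C₁ ∧ 0 < C₂ ∧ 0 < Q ∧ 0 < δ ∧ ∀ (msq : ℝ), 0 < msq → msq ≤ m0sq → ∀ (jv : KingVolIndex 3)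
      (Υ : Type) [Fintype Υ] [DecidableEq Υ] (vtx : Υ → Fin (2 + 1)) (υ₀ : Υ), vtx υ₀ = 0 →
      ∀ (b : Υ → Tor (kingVol L jv)) (κe : Υ → Option (Fin (3 + 1))) (υ₁ : Υ) (r : ℕ), 1 ≤ r →
      ∀ (vtxF : Fin r → Fin (2 + 1)) (κF : Fin r → Option (Fin (3 + 1))) (aI : ℝ), 0 ≤ aI → ∀ (A : Tor (kingVol L jv) → ℝ),
        (haveI := kingVol_neZero L jv
         ∀ w, |A w| ≤ aI * (1 + kingDist L jv (basePt (L ^ jv.K) (kingVol L jv) w) (basePt (L ^ jv.K) (kingVol L jv) (b υ₁)))) →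
        haveI := kingVol_neZero L jv
        |∑ w : Fin r → Tor (kingVol L jv), (∏ l, A (w l))
            * graphValLS ((((L : ℝ) ^ jv.K)⁻¹) ^ (3 + 1)) triSrc triTgt (fun _ => kingGLine L (kingVol L jv) a msq jv.K none) (Sum.elim vtx vtxF)
                (fun υ => kingExtLo L a msq jv (Sum.elim b w υ) (Sum.elim κe κF υ))|
          ≤ (Q * c368 3 δ) * (C₁ ^ 3 * C₂ ^ 2
                * (∑ π : Equiv.Perm (Fin 3), degConst L (kingDegList triSrc triTgt (((3 : ℕ) + 1 : ℕ) : ℝ)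
                    (fun ℓ => lineExp (3 + 1) ((fun _ : Fin 3 => (none : Option (Fin (3 + 1)))) ℓ)) π))
                * Q ^ (Fintype.card Υ + r - 1))
            * Real.exp (-(δ / 2 * treeLength (kingDist L jv) (anchors fun υ => some (basePt (L ^ jv.K) (kingVol L jv) (b υ)))))
            * (aI * (1 + 4 * r / δ) * (Real.exp (δ / (4 * r)) * latticeConst (3 + 1) (δ / (4 * r)))) ^ r := by
  obtain ⟨C₁, C₂, Q, δ, hC₁, hC₂, hQ, hδ, H⟩ := king_thm35_fieldPoints_extLegs_treeDecay (d := 3) L hLodd hL ha hm0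
  refine ⟨C₁, C₂, Q, δ, hC₁, hC₂, hQ, hδ, fun msq hm hcap jv Υ _ _ vtx υ₀ hυ₀ b κe υ₁ r hr vtxF κF aI haI A hA => ?_⟩
  haveI := kingVol_neZero L jv
  exact H msq hm hcap jv 2 3 triSrc triTgt lConn_triangle (fun _ => none) posDegrees_kingDegList_triangle
    Υ vtx υ₀ hυ₀ b κe υ₁ r hr vtxF κF aI haI A hA

end Summit.QuantumFields.YangMills.BalabanUVNodes.N15KingModelRung.Curved

end
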